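import Summits.CriticalPhenomena.PercolationContinuityZ3.Theorems.PercNearOneGluingNoHeavyLowerTailAntitheticCycleReflect
import HarnessLib

/-!
# `NoHeavyLowerTail` (stmt-CriticalPhenomena-4575) — antithetic cluster pairs: the ⊕-BOXES OF A CYCLE (cells of THEOREM ⊕-CYCLE,
# HOME/THEOREM-Theta.md §2, prim-hp-2 gen 62)

Support file (`--supports stmt-CriticalPhenomena-4575`, hull-port prover `prim-hp-2`, gen 62).  No definitions, no named facts, no sorries;
standard axioms.  Setting of …AntitheticCycleRuns: a cycle `v 0 = s, v 1, …, v (n-1), v n = v 0` (`n ≥ 3`), pairs `edge v i = v i v (i+1)`,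
`E = Cyc.edgeSet n v`; colourings `ω ⊆ Sym2 V` (`edge v i ∈ ω` = red); `X ω = openCluster (ω ∩ E) (v 0)`, `Y ω = openCluster (ωᶜ ∩ E) (v 0)`.
Fix a cycle vertex `P = v p`, `0 < p < n`.

THEOREM ⊕-CYCLE (HOME/THEOREM-Theta.md §2) says that the event `{P ∈ X}` is a disjoint union of RED-DOMINATED BOXES (…AntitheticBoxes), so that
`Σ_{ω : P ∈ X ω} K₁(X ω, Y ω)·K₂(X ω, Y ω) ≥ 0` for all super-odd twisted-monotone `K₁, K₂`.  The boxes ("punctured two-run cells"): the TOP box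
(all cycle pairs red) and, for each `k < n`, BOX `k`: the pair `edge v k` is BLUE and the arc from `edge v k` through `P` to `s` is RED — i.e.
the pairs `edge v i`, `k < i < n`, if `k < p`, resp. `edge v i`, `i < k`, if `p ≤ k` — all other pairs free (`k` = the blue pair NEAREST to `P`
on the non-red side).  This file proves the combinatorics:
* `Cyc.mem_X_iff` — `v a ∈ X ω` iff the clockwise arc `edge 0 … edge (a-1)` or the counter-clockwise arc `edge a … edge (n-1)` is red;
* `Cyc.oplus_cover` / `Cyc.mem_X_of_box` / `Cyc.mem_X_of_top` / `Cyc.box_uniq` — the boxes partition `{P ∈ X}`;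
* `Cyc.dom_box` / `Cyc.dom_top` — every box is red-dominated: if `ω, ω'` lie in the box and are opposite on its free pairs then `Y ω' ⊆ X ω`
  (stated for an arbitrary set of forced-red indices containing the arc, as needed again for the PR4 cells).
The summation (with a pendant stub hanging at another cycle vertex, via `Antithetic.Box.dom_path`) is …AntitheticCycleOplus.
[cite: VandenbergHaggstromKahn2005, §1 p. 3 (open cluster `C_s`)]
-/

noncomputable section

namespace Summit.CriticalPhenomena.PercolationContinuityZ3.Theorems

open Literature.Probability.Percolation
open scoped Classical

namespace Antithetic

namespace Cyc

variable {V : Type*} {n : ℕ} {v : ℕ → V} (hn : 3 ≤ n) (hinj : ∀ i j, i < n → j < n → v i = v j → i = j) (hper : v n = v 0)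
include hn hinj hper

/-- **Red reach of a cycle vertex, arc form.**  For `0 < a < n`: `v a ∈ X ω` iff the clockwise arc `edge 0, …, edge (a-1)` is red or the
counter-clockwise arc `edge a, …, edge (n-1)` is red. [this work] -/
theorem mem_X_iff (ω : Set (Sym2 V)) {a : ℕ} (ha0 : 0 < a) (han : a < n) :
    v a ∈ openCluster (ω ∩ edgeSet n v) (v 0) ↔
      (∀ i, i < a → edge v i ∈ ω) ∨ (∀ i, a ≤ i → i < n → edge v i ∈ ω) := by
  have P1 : a ≤ pre n v ω ↔ ∀ i, i < a → edge v i ∈ ω :=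
    ⟨fun h i hi => red_of_lt_pre ω (lt_of_lt_of_le hi h), fun h => le_pre ω han.le h⟩
  have S1 : n ≤ a + suf n v ω ↔ ∀ i, a ≤ i → i < n → edge v i ∈ ω := by
    constructor
    · intro h i hai hin
      have := red_of_lt_suf (n := n) (v := v) ω (j := n - 1 - i) (by omega)
      rwa [show n - 1 - (n - 1 - i) = i by omega] at this
    · intro h
      have := le_suf (n := n) (v := v) ω (b := n - a) (by omega) fun j hj => h _ (by omega) (by omega)
      omega
  show (openGraph (ω ∩ edgeSet n v)).Reachable (v 0) (v a) ↔ _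
  rw [reach_v_iff ω hn hinj hper ha0 han, P1, S1]

/-- A vertex in the red cluster of `s = v 0` is a cycle vertex `v b`, `b < n`. -/
theorem idx_of_mem_X (ω : Set (Sym2 V)) {u : V} (hu : u ∈ openCluster (ω ∩ edgeSet n v) (v 0)) : ∃ b, b < n ∧ u = v b := by
  obtain ⟨j, ⟨hj, rfl⟩ | ⟨hj, rfl⟩⟩ := (reach_iff ω hn hinj hper u).1 hu
  · have hjn : j ≤ n := hj.trans (pre_le ω)
    by_cases hjn' : j = n
    · exact ⟨0, by omega, by rw [hjn', hper]⟩
    · exact ⟨j, by omega, rfl⟩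
  · by_cases hj0 : j = 0
    · exact ⟨0, by omega, by rw [hj0, Nat.sub_zero, hper]⟩
    · exact ⟨n - j, by omega, rfl⟩

section Boxes

variable {p : ℕ} (hp0 : 0 < p) (hpn : p < n)
include hp0 hpn

/-- **Cover.**  If `P = v p ∈ X ω` then either every cycle pair is red (TOP box) or, for some `k < n`, `edge v k` is blue and the arc from
`edge v k` through `P` to `s` is red (BOX `k`). [this work] -/
theorem oplus_cover (ω : Set (Sym2 V)) (hP : v p ∈ openCluster (ω ∩ edgeSet n v) (v 0)) :
    (∀ i, i < n → edge v i ∈ ω) ∨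
      ∃ k, k < n ∧ edge v k ∉ ω ∧ ∀ i, i < n → ((k < p ∧ k < i) ∨ (p ≤ k ∧ i < k)) → edge v i ∈ ω := by
  by_cases hall : ∀ i, i < n → edge v i ∈ ω
  · exact Or.inl hall
  right
  push Not at hall
  obtain ⟨i₀, hi₀n, hi₀⟩ := hall
  rcases (mem_X_iff hn hinj hper ω hp0 hpn).1 hP with hcw | hccw
  · -- the clockwise arc to `P` is red: the blue pair nearest to `P` beyond it
    have hex : ∃ i, p ≤ i ∧ i < n ∧ edge v i ∉ ω := by
      by_cases hpi : p ≤ i₀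
      · exact ⟨i₀, hpi, hi₀n, hi₀⟩
      · exact absurd (hcw i₀ (by omega)) hi₀
    have hspec := Nat.find_spec hex
    refine ⟨Nat.find hex, hspec.2.1, hspec.2.2, fun i hi hor => ?_⟩
    rcases hor with ⟨hkp, -⟩ | ⟨-, hik⟩
    · exact absurd hspec.1 (by omega)
    · by_cases hip : i < p
      · exact hcw i hip
      · have hmin := Nat.find_min hex hik
        by_contra h
        exact hmin ⟨by omega, hi, h⟩
  · -- the counter-clockwise arc to `P` is red: the blue pair nearest to `P` before it
    have hex : ∃ j, j < p ∧ edge v (p - 1 - j) ∉ ω := by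
      by_cases hpi : i₀ < p
      · exact ⟨p - 1 - i₀, by omega, by rwa [show p - 1 - (p - 1 - i₀) = i₀ by omega]⟩
      · exact absurd (hccw i₀ (by omega) hi₀n) hi₀
    have hspec := Nat.find_spec hex
    refine ⟨p - 1 - Nat.find hex, by omega, hspec.2, fun i hi hor => ?_⟩
    rcases hor with ⟨-, hki⟩ | ⟨hpk, -⟩
    · by_cases hip : i < p
      · have hmin := Nat.find_min hex (m := p - 1 - i) (by omega)
        by_contra h
        exact hmin ⟨by omega, by rwa [show p - 1 - (p - 1 - i) = i by omega]⟩
      · exact hccw i (by omega) hi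
    · exact absurd hpk (by omega)

/-- **Inside, TOP box.**  If every cycle pair is red then `P ∈ X ω`. [this work] -/
theorem mem_X_of_top (ω : Set (Sym2 V)) (htop : ∀ i, i < n → edge v i ∈ ω) : v p ∈ openCluster (ω ∩ edgeSet n v) (v 0) :=
  (mem_X_iff hn hinj hper ω hp0 hpn).2 (Or.inl fun i hi => htop i (by omega))

/-- **Inside, BOX `k`.**  If the arc from `edge v k` through `P` to `s` is red then `P ∈ X ω`. [this work] -/
theorem mem_X_of_box (ω : Set (Sym2 V)) {k : ℕ} (hk : k < n)
    (hbox : ∀ i, i < n → ((k < p ∧ k < i) ∨ (p ≤ k ∧ i < k)) → edge v i ∈ ω) : v p ∈ openCluster (ω ∩ edgeSet n v) (v 0) := by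
  by_cases hkp : k < p
  · exact (mem_X_iff hn hinj hper ω hp0 hpn).2 (Or.inr fun i hpi hin => hbox i hin (Or.inl ⟨hkp, by omega⟩))
  · exact (mem_X_iff hn hinj hper ω hp0 hpn).2 (Or.inl fun i hi => hbox i (by omega) (Or.inr ⟨by omega, by omega⟩))

omit hn hinj hper hp0 hpn in
/-- **Uniqueness.**  A colouring lies in at most one BOX `k`. [this work] -/
theorem box_uniq (ω : Set (Sym2 V)) {k k' : ℕ} (hk : k < n) (hk' : k' < n) (hbk : edge v k ∉ ω)
    (hbox : ∀ i, i < n → ((k < p ∧ k < i) ∨ (p ≤ k ∧ i < k)) → edge v i ∈ ω) (hbk' : edge v k' ∉ ω)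
    (hbox' : ∀ i, i < n → ((k' < p ∧ k' < i) ∨ (p ≤ k' ∧ i < k')) → edge v i ∈ ω) : k = k' := by
  by_contra hne
  rcases Nat.lt_or_gt_of_ne hne with hlt | hgt
  · by_cases hk'p : k' < p
    · exact hbk' (hbox k' hk' (Or.inl ⟨by omega, hlt⟩))
    · exact hbk (hbox' k hk (Or.inr ⟨by omega, hlt⟩))
  · by_cases hkp : k < p
    · exact hbk (hbox' k hk (Or.inl ⟨by omega, hgt⟩))
    · exact hbk' (hbox k' hk' (Or.inr ⟨by omega, hgt⟩))

end Boxes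

/-- **Red domination, TOP box.**  If every cycle pair of `ω'` is red then `Y ω' = {s} ⊆ X ω`. [this work] -/
theorem dom_top (ω ω' : Set (Sym2 V)) (hω' : ∀ i, i < n → edge v i ∈ ω') :
    openCluster (ω'ᶜ ∩ edgeSet n v) (v 0) ⊆ openCluster (ω ∩ edgeSet n v) (v 0) := by
  intro u hu
  obtain ⟨b, hbn, rfl⟩ := idx_of_mem_X hn hinj hper ω'ᶜ hu
  by_cases hb0 : b = 0
  · rw [hb0]; exact mem_openCluster_self _ _
  · exfalso
    rcases (mem_X_iff hn hinj hper ω'ᶜ (Nat.pos_of_ne_zero hb0) hbn).1 hu with h | h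
    · exact h 0 (Nat.pos_of_ne_zero hb0) (hω' 0 (by omega))
    · exact h (n - 1) (by omega) (by omega) (hω' (n - 1) (by omega))

/-- **Red domination, one blue pair.**  Let `red` be a set of forced-red indices containing a whole arc from the pair `k` to `s` — all `i` with
`k < i < n` (and `k + 1 < n`), or all `i < k` (and `0 < k`) — but not `k`.  If `ω, ω'` are red on `red` and opposite on the pairs that are
neither `k` nor forced, then `Y ω' ⊆ X ω`.  (BOX `k` of the ⊕-partition: `red` = the arc through `P`; the PR4 cells add two more forced
pairs.) [this work] -/
theorem dom_box (ω ω' : Set (Sym2 V)) {k : ℕ} (red : ℕ → Prop)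
    (harc : (k + 1 < n ∧ ∀ i, k < i → i < n → red i) ∨ (0 < k ∧ ∀ i, i < k → red i))
    (hω : ∀ i, i < n → red i → edge v i ∈ ω) (hω' : ∀ i, i < n → red i → edge v i ∈ ω')
    (hflip : ∀ i, i < n → i ≠ k → ¬ red i → (edge v i ∈ ω' ↔ edge v i ∉ ω)) :
    openCluster (ω'ᶜ ∩ edgeSet n v) (v 0) ⊆ openCluster (ω ∩ edgeSet n v) (v 0) := by
  intro u hu
  obtain ⟨b, hbn, rfl⟩ := idx_of_mem_X hn hinj hper ω'ᶜ hu
  by_cases hb0 : b = 0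
  · rw [hb0]; exact mem_openCluster_self _ _
  have hb0' : 0 < b := Nat.pos_of_ne_zero hb0
  have hu' := (mem_X_iff hn hinj hper ω'ᶜ hb0' hbn).1 hu
  -- a free pair that is blue in `ω'` is red in `ω`
  have hfree : ∀ i, i < n → i ≠ k → edge v i ∉ ω' → edge v i ∈ ω := by
    intro i hi hik hiω'
    have hri : ¬ red i := fun h => hiω' (hω' i hi h)
    by_contra h
    exact hiω' ((hflip i hi hik hri).2 h)
  rcases harc with ⟨hkn, hA⟩ | ⟨hk0, hB⟩
  · -- forced arc `k < i < n`: the blue route of `ω'` to `v b` is clockwise and stops at `v (k+1)` at the latest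
    rcases hu' with hcw | hccw
    · by_cases hbk : b ≤ k
      · exact (mem_X_iff hn hinj hper ω hb0' hbn).2
          (Or.inl fun i hi => hfree i (by omega) (by omega) (hcw i hi))
      · by_cases hbk' : b = k + 1
        · exact (mem_X_iff hn hinj hper ω hb0' hbn).2 (Or.inr fun i hbi hin => hω i hin (hA i (by omega) hin))
        · exact absurd (hω' (k + 1) hkn (hA (k + 1) (Nat.lt_succ_self k) hkn)) (hcw (k + 1) (by omega))
    · exact absurd (hω' (n - 1) (by omega) (hA (n - 1) (by omega) (by omega))) (hccw (n - 1) (by omega) (by omega))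
  · -- forced arc `i < k`: the blue route of `ω'` to `v b` is counter-clockwise and stops at `v k` at the latest
    rcases hu' with hcw | hccw
    · exact absurd (hω' 0 (by omega) (hB 0 hk0)) (hcw 0 hb0')
    · by_cases hbk : k < b
      · exact (mem_X_iff hn hinj hper ω hb0' hbn).2
          (Or.inr fun i hbi hin => hfree i hin (by omega) (hccw i hbi hin))
      · by_cases hbk' : b = k
        · exact (mem_X_iff hn hinj hper ω hb0' hbn).2 (Or.inl fun i hi => hω i (by omega) (hB i (by omega)))
        · exact absurd (hω' b hbn (hB b (by omega))) (hccw b le_rfl hbn)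

end Cyc

end Antithetic

end Summit.CriticalPhenomena.PercolationContinuityZ3.Theorems
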